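import Literature.Computability.AlgebraicComplexity.SymmetricDetRepresentationProofs
import Mathlib.RingTheory.MvPolynomial.Homogeneous

/-!
# Crux `DetQP.DetqpThesis` (stmt-ValiantsHypothesis-0315) — line `one-cut-strength`,
# stub `stub_detCalibration`: the determinant has polynomial one-cut strength at EVERY cut

Registered stub S4 of `Cruxes/DetqpThesis/Lines/one_cut_strength.lean` (wall-breaker strategist line;
calibration, NOT load-bearing; Disproof (B) of the line: the bet `OneCutStrengthNotQP` is specific to
the permanent), proved VERBATIM with `c = 2`:

> for all `n` and every cut `1 ≤ a < n`, `det_n = Σ_{k<r} g_k · h_k` with `r ≤ (n+2)²` terms,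
> `g_k` homogeneous of degree `a`, `h_k` homogeneous of degree `n − a`.

## Proof (cut the Mahajan–Vinay branching program at layer `a`)

The tree's signed clow dynamics (`GKKP2011.sv`, `SymmetricDetRepresentationProofs.lean`, Part B:
Mahajan–Vinay 1997 §3 in Berkowitz's orientation) is a LAYERED program on the `n²` states
`Fin n × Fin n` whose source row `start₀` and one-layer transfer matrix `T₀` have entries `± X_{ij}`
or `0` — homogeneous linear — and whose value after `n` edges is
`Σ_t sv n (t,t) = [X⁰] χ(M_n)` (`GKKP2011.sum_sv_diag`), i.e. `(-1)ⁿ det_n`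
(`Matrix.det_eq_sign_charpoly_coeff`, `Berkowitz.genBlock_self`). Since
`start₀ · T₀^{n-1} = sv n` (`GKKP2011.start₀_vecMul_pow`) and `T₀^{n-1} = T₀^{a-1} · T₀^{n-a}`,
`det_n = Σ_σ g_σ h_σ` over the `n²` states `σ` with `g_σ = (start₀ · T₀^{a-1})_σ` (degree `a`) and
`h_σ = (-1)ⁿ Σ_t (T₀^{n-a})_{σ,(t,t)}` (degree `n - a`); homogeneity by induction over the layers
(`IsHomogeneous.mul/.sum`).

Honest framing: a calibration (the determinant side of the one-cut-strength line); the crux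
`DetqpThesis` and the line's bet are OPEN; nothing here bears on `VP ≠ VNP`.
-/

-- Sub = Summit layout duplicates the namespace component
set_option linter.dupNamespace false

noncomputable section

namespace Summit.ValiantsHypothesis.ValiantsHypothesis.Theorems.DetqpThesis.OneCutStrength

open MvPolynomial Finset Literature.Computability.AlgebraicComplexity
open Literature.Computability.AlgebraicComplexity.GKKP2011
open Literature.Computability.AlgebraicComplexity.Berkowitz
open scoped Matrix

variable {k : Type*} [CommRing k] {n : ℕ}

/-! ### Homogeneity of the layers -/

/-- `xvar k n f u` (`X_{fu}` or `0`) is homogeneous of degree `1`. [folklore] -/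
theorem isHomogeneous_xvar (f u : ℕ) : (xvar k n f u).IsHomogeneous 1 := by
  unfold xvar
  split_ifs
  · exact isHomogeneous_X _ _
  · exact isHomogeneous_zero _ _ _

/-- Every edge weight `stepW` is homogeneous of degree `1`. [folklore] -/
theorem isHomogeneous_stepW (f t' u' : ℕ) : (stepW k n f t' u').IsHomogeneous 1 := by
  unfold stepW
  split_ifs
  · exact isHomogeneous_xvar f u'
  · exact (isHomogeneous_xvar f t').neg
  · exact isHomogeneous_zero _ _ _

/-- Entries of the transfer matrix `T₀` are homogeneous of degree `1`. [folklore] -/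
theorem isHomogeneous_T₀ (σ σ' : Fin n × Fin n) : (T₀ k n σ σ').IsHomogeneous 1 := by
  simp only [T₀, Matrix.of_apply]
  split_ifs
  · exact isHomogeneous_stepW _ _ _
  · exact isHomogeneous_zero _ _ _
  · exact isHomogeneous_stepW _ _ _
  · exact isHomogeneous_zero _ _ _
  · exact isHomogeneous_zero _ _ _

/-- Entries of the source row `start₀` are homogeneous of degree `1`. [folklore] -/
theorem isHomogeneous_start₀ (σ : Fin n × Fin n) : (start₀ k n σ).IsHomogeneous 1 :=
  isHomogeneous_stepW _ _ _

/-- Entries of `T₀^d` are homogeneous of degree `d`. [folklore] -/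
theorem isHomogeneous_T₀_pow (d : ℕ) (σ σ' : Fin n × Fin n) :
    ((T₀ k n ^ d) σ σ').IsHomogeneous d := by
  induction d generalizing σ σ' with
  | zero =>
    rw [pow_zero, Matrix.one_apply]
    split_ifs
    · exact isHomogeneous_one _ _
    · exact isHomogeneous_zero _ _ _
  | succ d ih =>
    rw [pow_succ, Matrix.mul_apply]
    exact IsHomogeneous.sum _ _ _ fun τ _ => (ih σ τ).mul (isHomogeneous_T₀ τ σ')

/-- Entries of `start₀ · T₀^d` are homogeneous of degree `d + 1`. [folklore] -/
theorem isHomogeneous_start₀_vecMul_pow (d : ℕ) (σ : Fin n × Fin n) :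
    ((start₀ k n ᵥ* T₀ k n ^ d) σ).IsHomogeneous (d + 1) := by
  rw [Matrix.vecMul, dotProduct]
  refine IsHomogeneous.sum _ _ _ fun τ _ => ?_
  rw [add_comm]
  exact (isHomogeneous_start₀ τ).mul (isHomogeneous_T₀_pow d τ σ)

/-! ### The determinant as the value of the program, cut at layer `a` -/

/-- `det_n = (-1)ⁿ · Σ_{t<n} sv n (t, t)` for `n ≠ 0` (the value of the Mahajan–Vinay program,
`sum_sv_diag`, `det = (-1)^n [X⁰]χ`). [cite: MahajanVinay1997, §3 Thm 2] -/
theorem detPoly_eq_sign_mul_sum_sv (hn : n ≠ 0) :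
    detPoly (Fin n) k = C ((-1 : k) ^ n) * ∑ t : Fin n, sv k n n t t := by
  rw [Fin.sum_univ_eq_sum_range (fun t => sv k n n t t) n, sum_sv_diag, if_neg hn, sub_zero,
    detPoly, ← genBlock_self, Matrix.det_eq_sign_charpoly_coeff, Fintype.card_fin, map_pow, map_neg,
    map_one]
  rfl

/-- The cut decomposition: for `1 ≤ a ≤ n` (and `n ≠ 0`),
`det_n = Σ_σ (start₀ · T₀^{a-1})_σ · ((-1)ⁿ Σ_t (T₀^{n-a})_{σ,(t,t)})`. [folklore] -/
theorem detPoly_eq_sum_cut {a : ℕ} (ha : 1 ≤ a) (han : a ≤ n) :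
    detPoly (Fin n) k = ∑ σ : Fin n × Fin n,
      (start₀ k n ᵥ* T₀ k n ^ (a - 1)) σ *
        (C ((-1 : k) ^ n) * ∑ t : Fin n, (T₀ k n ^ (n - a)) σ (t, t)) := by
  have hn : n ≠ 0 := by omega
  rw [detPoly_eq_sign_mul_sum_sv hn]
  have hsv : ∀ t : Fin n, sv k n n t t = (start₀ k n ᵥ* T₀ k n ^ (n - 1)) (t, t) := by
    intro t
    rw [start₀_vecMul_pow, Nat.sub_add_cancel (Nat.one_le_iff_ne_zero.2 hn)]
  have hpow : T₀ k n ^ (n - 1) = T₀ k n ^ (a - 1) * T₀ k n ^ (n - a) := by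
    rw [← pow_add]; congr 1; omega
  simp_rw [hsv, hpow, ← Matrix.vecMul_vecMul]
  simp only [Matrix.vecMul, dotProduct]
  rw [Finset.mul_sum]
  simp_rw [Finset.mul_sum]
  rw [Finset.sum_comm]
  refine Finset.sum_congr rfl fun σ _ => ?_
  simp_rw [← Finset.mul_sum]
  ring

/-! ### The calibration -/

/-- **Stub `stub_detCalibration`** (line `one-cut-strength` of crux `DetQP.DetqpThesis`,
stmt-ValiantsHypothesis-0315; registered signature verbatim, with `c = 2`): for every `n` and every
cut `1 ≤ a < n` the generic determinant has an `(a, n-a)`-decomposition with `r = n² ≤ (n+2)²`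
terms — cut the Mahajan–Vinay branching program at layer `a`. -/
theorem stub_detCalibration : ∃ c : ℕ, ∀ n a : ℕ, 1 ≤ a → a < n →
    ∃ r : ℕ, r ≤ (n + 2) ^ c ∧ ∃ g h : Fin r → MvPolynomial (Fin n × Fin n) ℂ,
      (∀ k, (g k).IsHomogeneous a) ∧ (∀ k, (h k).IsHomogeneous (n - a)) ∧
      detPoly (Fin n) ℂ = ∑ k, g k * h k := by
  refine ⟨2, fun n a ha han => ⟨n * n, by nlinarith, ?_⟩⟩
  refine ⟨fun i => (start₀ ℂ n ᵥ* T₀ ℂ n ^ (a - 1)) (finProdFinEquiv.symm i),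
    fun i => C ((-1 : ℂ) ^ n) * ∑ t : Fin n, (T₀ ℂ n ^ (n - a)) (finProdFinEquiv.symm i) (t, t),
    fun i => ?_, fun i => ?_, ?_⟩
  · have h := isHomogeneous_start₀_vecMul_pow (k := ℂ) (a - 1) (finProdFinEquiv.symm i)
    rwa [Nat.sub_add_cancel ha] at h
  · have h := (isHomogeneous_C (Fin n × Fin n) ((-1 : ℂ) ^ n)).mul
      (IsHomogeneous.sum (Finset.univ : Finset (Fin n)) _ (n - a)
        fun t _ => isHomogeneous_T₀_pow (k := ℂ) (n - a) (finProdFinEquiv.symm i) (t, t))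
    rwa [zero_add] at h
  · rw [detPoly_eq_sum_cut ha han.le]
    exact (Fintype.sum_equiv finProdFinEquiv.symm _ _ fun i => rfl).symm

end Summit.ValiantsHypothesis.ValiantsHypothesis.Theorems.DetqpThesis.OneCutStrength

end
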